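import Literature.NumberTheory.EllipticCurves.BDPAnticyclotomicPAdicLFunction
import Literature.NumberTheory.EllipticCurves.PadicFormalLogOrder
import HarnessLib

/-!
# Castella 2018, Thm. 3.2 (jointly with Thm. 3.1): the `p`-adic Waldspurger formula for the
# anticyclotomic `p`-adic `L`-function `L_p(f) ∈ Λ_{R₀}` at the trivial character —
# `L_p(f, 𝟙) = (1 − a_p p⁻¹ + ε_p)² · (log_{ω_E} P_K)²` up to a `p`-adic unit

Trunk T-NT-EC (`Literature/NumberTheory/EllipticCurves`), story `Castella2018/` (Camb. J. Math. 6
(2018); the erratum file `MultiplicativePPartErratum.lean` records which part of the paper is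
withdrawn — Thm. 4.2 / Thm. 4.4 and, through them, the proof of Thm. A at `p ∥ N` — and that §3
(Thms. 3.1, 3.2) and the assembly of §5 are NOT affected: the erratum's replacement argument uses
them as printed). HONEST FRAMING (cell `b2b-bsdres`, run/shared/lean/b2b/bsd-rank1-residual/): the
goal of the cell is to DELETE the COMBINATION-SHAPED residual classes of the Birch–Swinnerton-Dyer
formula for ALL analytic-rank `≤ 1` elliptic curves over `ℚ` from PUBLISHED theorems only; the
CONSTRUCTION-SHAPED classes are TYPED, not attempted; this is not "finishing BSD". This file: ONE
definition with a body (the READING `log_{ω_E} P ∈ ℚ_p` of a printed symbol, the element whose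
`ord_p` is the tree's `padicLogOrd`), ONE named fact (`def … : Prop`, nothing asserted; D-0014/D-0026
accounting: +1), and small proved API. Unit `b2b-bsdres-multr1-p1` (X11b, route R1, gen 21):
consumer `Summits/BirchSwinnertonDyer/Rank1Residual/X11b/RouteR1BDPValue.lean`, which DISCHARGES with
it the typed PUB-shaped half H2 = `X11b.R1.BDPValueOnTree` of the route's open input (gen 20,
`X11b/RouteR1Halves.lean`), leaving the single OPEN half H3 (erratum Thm. 1.1, the anticyclotomic
main conjecture for Castella's `L_p(f)`).

## The printed statements (Castella, Camb. J. Math. 6 (2018) 1–23 = arXiv:1704.06608, §3, p. 9;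
## read by this seat on the held text `paper:arxiv-1704.06608` p0009, and before it by the cell's
## literature seats: x11b3 `LIT1-HOWARD-CASTELLA-HYPOTHESES.md` l. 208–212, `ROUTE-2.md` §3)

Standing (§2.1, p. 5, verbatim): "Let `E/ℚ` be a semistable elliptic curve of conductor `N`, and let
`p ≥ 5` be a prime such that the mod `p` Galois representations `ρ̄_{E,p} : Gal(ℚ̄/ℚ) → Aut_{𝔽_p}(E[p])`
is irreducible. … Let `K` be an imaginary quadratic field in which `p = 𝔭𝔭̄` splits"; (§3, p. 9)
"In this section, we assume in addition that `K` satisfies the following Heegner hypothesis relative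
to the square-free integer `N`: (Heeg) every prime factor of `N` is either split or ramified in `K`."
**Theorem 3.1** = the tree's `castella2018_exists_isBDPLFunction` (registry A206): "There exists a
`p`-adic `L`-function `L_p(f) ∈ Λ_{R₀}` such that …" (interpolation at unramified anticyclotomic Hecke
characters of infinity type `(-n, n)`, `n > 0`; tree predicate `IsBDPLFunction ι 𝔭 κ γ f Ω_K Ω_p L`).
Then (p. 9, verbatim): "`p`-adic Waldspurger formula. We will have use for the following formula for
the value at the trivial character `𝟙` of the `p`-adic `L`-function of Theorem 3.1. Recall that `E/ℚ`
is assumed to be semistable. From now on, we shall also assume that `E` is an optimal quotient of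
the new part of `J₀(N) = Jac(X₀(N))` in the sense of [Mazur 1978], and fix a corresponding modular
parametrization `π : X₀(N) → E` sending the cusp `∞` to the origin of `E`. If `ω_E` a Néron
differential on `E`, and `ω_f = ∑ aₙ qⁿ dq/q` is the one-form on `J₀(N)` associated with `f`, then
(3.2) `π^*(ω_E) = c · ω_f`, for some `c ∈ ℤ_{(p)}^×` (see [Mazur 1978]). **Theorem 3.2.** The
following equality holds up to a `p`-adic unit: `L_p(f, 𝟙) = (1 − a_p p⁻¹ + ε_p)² · (log_{ω_E} P_K)²`,
where `ε_p = p⁻¹` if `p ∤ N` and `ε_p = 0` otherwise, and `P_K ∈ E(K)` is a Heegner point. *Proof.*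
This follows from [BDP 2013] and [Castella–Hsieh 2018] in the case `p ∤ N` and [cas-split] in the case
`p ∣ N`. Indeed, in our case, the generalized Heegner cycles `Δ` constructed in either of these
references are of the form `Δ = [(A, A[𝔑]) − (∞)] ∈ J₀(N)(H)`, where `H` is the Hilbert class field of
`K`, and `(A, A[𝔑])` is a CM elliptic curve equipped with a cyclic `N`-isogeny. Letting `F` denote
the `p`-adic completion of `H`, the aforementioned references then yield the equality (3.3)
`L_p(f, 𝟙) = (1 − a_p p⁻¹ + ε_p)² · (∑_{σ ∈ Gal(H/K)} AJ_F(Δ^σ)(ω_f))²`. By [BK], the `p`-adic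
Abel–Jacobi map appearing in (3.3) is related to the formal group logarithm on `J₀(N)` by the formula
`AJ_F(Δ)(ω_f) = log_{ω_f}(Δ)`, and by (3.2) we have the equalities up to a `p`-adic unit:
`log_{ω_f}(Δ) = log_{π^*(ω_E)}(π(Δ)) = log_{ω_E}(π(Δ))`. Thus, taking
`P_K := ∑_{σ ∈ Gal(H/K)} π(Δ^σ) ∈ E(K)`, the result follows." Here `log_{ω_E}` is (§2.2, p. 5) "the
formal group logarithm attached to a fixed invariant differential `ω_E` on `Ê`", "`log_{ω_E} :
E(K_𝔭)_{/tor} ⊗ ℤ_p → ℤ_p`" (`K_𝔭 = ℚ_p`), `𝔭` being the prime induced by the fixed embeddings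
`ι_∞ : ℚ̄ ↪ ℂ`, `ι_p : ℚ̄ ↪ ℂ_p` (Castella–Hsieh 2018, §3.3).

## Transcription (tree vocabulary only; nothing re-declared)

* The binders of Thm. 3.1 VERBATIM those of A206 `castella2018_exists_isBDPLFunction` (`5 ≤ p`;
  `Squarefree N` for "semistable of conductor `N`" at the level `N` of the newform; irreducible
  `ρ̄_{E,p}`; `K` imaginary quadratic with `p` split; the distinguished `𝔭 ∋ p` COMPATIBLE with the
  embedding datum `ι : ℚ̄_p ≃ ℂ` read through Mathlib's embedding of the infinite place(s) of `K`;
  (Heeg) in the residue-degree-one form; `κ` anticyclotomic with topological generator `γ`).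
* "`π : X₀(N) → E` … (3.2) `π^*(ω_E) = c · ω_f`" = a modular parametrisation datum
  `Dt : ModularParametrizationData W N` of the tree (`ModularCurve.lean`: its derived map
  `Dt.φ(τ) = uniformize (c · 2πi ∫_{i∞}^τ f)` has `φ^* ω_E = c · 2πi f(τ)dτ = c · ω_f` with `c = Dt.c`
  and sends `i∞` to `O`; `Dt.f` is the newform of `W`, `Dt.isNewformOf`), for `W` GLOBALLY MINIMAL
  (so that `ω_W = dx/(2y + a₁x + a₃)` is a Néron differential `ω_E`); "`c ∈ ℤ_{(p)}^×`" = `¬ p ∣ Dt.c`.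
* "`P_K := ∑_{σ ∈ Gal(H/K)} π(Δ^σ)`, `Δ = [(A, A[𝔑]) − (∞)]`" = the tree's Heegner point
  `heegnerPointComplex Dt H = ∑_{[Q]} φ(τ_Q) = Tr_{H_K/K} φ((𝓞_K, 𝔫, [𝓞_K]))` of a Heegner datum
  `H : HeegnerDatum N d_K` (`HeegnerPoints.lean`; the residue `β` of `H` is the choice of `𝔑`), read as
  a `K`-rational point `P` through THE SAME complex embedding `w.embedding` of `K` as the one through
  which A206 reads Castella's `ι_∞|_K` (`P.map w.embedding = heegnerPointComplex Dt H`).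
* "`log_{ω_E} P_K`", `P_K ∈ E(K) ⊂ E(K_𝔭) = E(ℚ_p)`: `padicLogOmega W p e P` for an embedding
  `e : K →+* ℚ_p` INDUCING `𝔭` (`k ∈ 𝔭 ↔ ‖e k‖ < 1`, the currency of the tree's
  `JetchevSkinnerWan2017.thm331_anticyclotomicControl`) — the element of `ℚ_p` whose `ord_p` is the
  tree's `padicLogOrd W p e P` (`valuation_padicLogOmega`).
* "`a_p`" = `a_p(f) = a_p(E)` = `W.LFunction p` (`IsNewformOf`: `aₙ(f) = aₙ(W)`); "`ε_p`" as in the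
  tree's `bdpInterpolationValue` (`p⁻¹` if `p ∤ N`, else `0`).
* "`L_p(f, 𝟙)`" = the value of `L ∈ R₀⟦T⟧` at `T = 0` (`UnrSeries.HasValueAt L 0 _`, the constant
  term: `UnrSeries.hasValueAt_zero`); "up to a `p`-adic unit" = up to `u ∈ R₀ˣ` (both sides lie in
  `Frac R₀ = \widehat{ℚ_p^ur}`; `R₀ = unrIntegers p`).
* WHICH `L`: Thm. 3.2 is a statement about THE `L_p(f)` of Thm. 3.1. The tree has no CM period pair
  (`Ω_K`, `Ω_p` of Castella–Hsieh §2.5 are not definable with a body today — registry design debt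
  D-S-g10-2), so A206 quantifies `(Ω_K, Ω_p, L)` existentially; accordingly Thms. 3.1 ∧ 3.2 — two
  numbered theorems of ONE paper about ONE object — are transcribed JOINTLY in A206's `∃∧`-currency:
  `∃ Ω_K ≠ 0, Ω_p ∈ R₀ˣ, L`, interpolation property AND value at `𝟙`. This is weaker than, and
  implied by, the printed pair of statements (pattern of the registry's same-paper composites at the
  trivial character, e.g. `YanZhu2026.thm412_thm513_generator_constantCoeff`); it implies A206 on its
  (smaller) domain. No cross-paper clause.

## Flags for the registry / D-audit (nothing hidden)

* `Cas18-Thm32-parametrisation-via-(3.2)`: the printed standing assumption is "`E` an optimal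
  quotient … (3.2) `π^*(ω_E) = c·ω_f` for some `c ∈ ℤ_{(p)}^×` (see [Mazur])"; the proof uses optimality
  ONLY through (3.2) with `c` a `p`-adic unit (last display of the proof), and §5 of the same paper
  applies Thm. 3.2 to the (not necessarily optimal) curve `E` of Thm. A. The binder here is (3.2)
  itself: a parametrisation datum `Dt` of `W` at level `N` with `p ∤ Dt.c`. For the optimal curve and
  odd `p` with `p² ∤ N` this binder is the registered fact `mazur_not_dvd_maninConstant_of_odd`.
* `Cas18-Thm32-pN-via-cas-split`: at `p ∣ N` the printed proof is "[cas-split]" = Castella, J. Inst.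
  Math. Jussieu 17 (2018) (arXiv:1507.04260), Thm. 2.11, stated and proved for "a `p`-new eigenform
  `f ∈ S_k(Γ₀(Np))` of weight `k = r + 2 ≥ 2`" with `a_p(f)` symbolic (p0014), inside a paper whose §1
  standing setting is "`p ≥ 5` … `f` split multiplicative at `p`" (p0003); Cas18 Thm. 3.2 itself is
  printed for every semistable `E` and `p ≥ 5` (so both signs `a_p = ±1` at `p ∥ N`, and good `p`).
  Transcribed AS PRINTED in Cas18 (refereed); the cell's x11b3 REFEREE §2 rows H3/H4 record the same
  reading question at `p = 3`, where NOTHING is claimed here (`5 ≤ p`).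
* `Cas18-Thm32-dK-odd@BDP13` (second level; proof-by-citation): Thm. 3.2 is printed for every `K` with
  `p` split and (Heeg) — no parity of `d_K` — and is transcribed so; BOTH legs of its printed proof rest
  on [BDP13] computations printed under Assumption 5.12 (2)(3) / Thm. 4.6 ("`c` and `d_K` odd"; Rem. 4.7
  "for convenience to simplify the local calculations"): at `p ∤ N` "[bdp1] and [cas-hsieh1]"
  ([CasHsieh2018]'s own `p`-adic Gross–Zagier theorem treats `p`-ramified characters of conductor
  `p^n`, `n ≥ 2`; the trivial character is [BDP13, Thm. 5.13]'s), at `p ∣ N` "[cas-split]"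
  = [Castella2018Exceptional] Thms. 2.10–2.11, whose proofs are "See Theorem 5.9, Proposition 5.10, and
  equation (5.2.4) of [bdp1]" / "The proof of [bdp1] shows …" with `L_alg` defined through
  "[bdp1, Thm. 4.6]"'s constant (arXiv:1507.04260 pp. 13–14). Every current consumer instantiates `K`
  with `d_K` odd (X11b: `Cas20Standing`, `P2.BDPValueOnTree`; erratum fields by
  `IsErratumField.odd_discr`) except the CONDITIONAL X6 classical-data frames (`discr K < -4` only):
  0 booked cells at even `d_K` (ARM P D-audit r08 ADDENDUM-1, 2026-08-26). Parity-free BDP-type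
  formulas exist in later print (e.g. Liu–Zhang–Zhang, Duke Math. J. 167 (2018)) — not this proof's
  citations, not read by the cell.
* `Cas18-Thm32-unit-currency`: "up to a `p`-adic unit" read as `u ∈ R₀ˣ` (see above).

## References

* [Castella2018] F. Castella, *On the `p`-part of the Birch–Swinnerton-Dyer formula for
  multiplicative primes*, Camb. J. Math. 6 (2018) 1–23, §2.1–2.2 (p. 5), Thm. 3.1, display (3.2),
  Thm. 3.2 and its proof (arXiv:1704.06608 p. 9), §5 (p. 12).
* [Castella2018Exceptional] F. Castella, *On the exceptional specializations of big Heegner points*,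
  J. Inst. Math. Jussieu 17 (2018), Thm. 2.10, Thm. 2.11 (arXiv:1507.04260 pp. 13–14) — "[cas-split]".
* [CastellaHsieh2018] F. Castella, M.-L. Hsieh, *Heegner cycles and `p`-adic `L`-functions*, Math.
  Ann. 370 (2018), §2.5 (CM periods), §3.3 (conventions), Prop. 3.6 / Thm. 4.9 (`p ∤ N`).
* [BertoliniDarmonPrasanna2013] M. Bertolini, H. Darmon, K. Prasanna, Duke Math. J. 162 (2013),
  Thm. 5.13 (the value at the trivial character, `p ∤ N`).
* [BlochKato1990] S. Bloch, K. Kato, *`L`-functions and Tamagawa numbers of motives* (1990), §3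
  ("[BK]": `AJ_F = log`).
* [Mazur1978] B. Mazur, *Rational isogenies of prime degree*, Invent. Math. 44 (1978), Cor. 4.1.
-/

noncomputable section

open scoped Classical MatrixGroups ModularForm
open CongruenceSubgroup NumberField IsDedekindDomain Field WeierstrassCurve
open Literature.NumberTheory.EllipticCurves.ModularForms

namespace Literature.NumberTheory.EllipticCurves.Castella2018

/-! ### §1 The reading `log_{ω_E} P ∈ ℚ_p` (the element; its `ord_p` is the tree's `padicLogOrd`) -/

section Log

variable (W : WeierstrassCurve ℚ) (p : ℕ) [Fact p.Prime] {K : Type} [Field K] [NumberField K]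

/-- **`log_{ω_E} P ∈ ℚ_p`** for `P ∈ E(K)` read in `E(ℚ_p)` along an embedding `ι : K →+* ℚ_p`, `W`
globally minimal (so `ω_W` is a Néron differential `ω_E` and `W ⊗ ℚ_p` is `ℤ_p`-minimal): the
`ℤ_p`-linear extension `log P := log_W(z(m₀ • P_ι))/m₀` of the formal-group logarithm
(`padicLogPoint = log_W ∘ z`, AEC IV.6.4 / VII.2.2) from `E₁(ℚ_p)` to `E(ℚ_p)`, `m₀ = [E(ℚ_p):E₁(ℚ_p)]`
the tree's `formalIndex` — Castella's "`log_{ω_E} : E(K_𝔭)_{/tor} ⊗ ℤ_p → ℤ_p`" (§2.2, proof of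
Thm. 2.3) evaluated at `P`. The ELEMENT whose valuation is the tree's `padicLogOrd W p ι P`
(`valuation_padicLogOmega`); same body as the cell's Summits-side `X11b.Halves.logOmega` (so the two
agree by `rfl`). A definition (a reading); nothing asserted.
[cite: Castella2018, §2.2 and Thm. 2.3 (arXiv:1704.06608 p. 5), Thm. 3.2 (p. 9) (the symbol `log_{ω_E} P_K`)]
[cite: SilvermanAEC2009, IV.6.4 and VII.2.2] -/
def padicLogOmega [W.IsElliptic] [W.IsGloballyMinimal] (ι : K →+* ℚ_[p])
    (P : (W.baseChange K).toAffine.Point) : ℚ_[p] :=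
  (W.baseChange ℚ_[p]).padicLogPoint (formalIndex W p • padicPointOf W p ι P) /
    (formalIndex W p : ℚ_[p])

variable {W p} in
/-- `ord_p log_{ω_E} P = padicLogOrd W p ι P` whenever `log_{ω_E} P ≠ 0` (`ord_p(x/m₀) = ord_p x −
ord_p m₀`). [cite: Castella2018, Thm. 2.3 (arXiv:1704.06608 p. 5) (the quantity `ord_p log_{ω_E} P`)] -/
theorem valuation_padicLogOmega [W.IsElliptic] [W.IsGloballyMinimal] {ι : K →+* ℚ_[p]}
    {P : (W.baseChange K).toAffine.Point} (h : padicLogOmega W p ι P ≠ 0) :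
    (padicLogOmega W p ι P).valuation = padicLogOrd W p ι P := by
  unfold padicLogOmega at h ⊢
  set A := (W.baseChange ℚ_[p]).padicLogPoint (formalIndex W p • padicPointOf W p ι P) with hA
  have hA0 : A ≠ 0 := by
    intro h0; apply h; rw [h0, zero_div]
  have hm0 : (formalIndex W p : ℚ_[p]) ≠ 0 := by
    intro h0; apply h; rw [h0, div_zero]
  rw [div_eq_mul_inv, Padic.valuation_mul hA0 (inv_ne_zero hm0), Padic.valuation_inv,
    Padic.valuation_natCast, padicLogOrd]
  ring

/-- `log_{ω_E} P = 0` or its valuation is `padicLogOrd W p ι P` (the dichotomy used by consumers that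
only see `ord_p`). [cite: Castella2018, Thm. 2.3 (arXiv:1704.06608 p. 5)] -/
theorem padicLogOmega_eq_zero_or_valuation_eq [W.IsElliptic] [W.IsGloballyMinimal] (ι : K →+* ℚ_[p])
    (P : (W.baseChange K).toAffine.Point) :
    padicLogOmega W p ι P = 0 ∨ (padicLogOmega W p ι P).valuation = padicLogOrd W p ι P := by
  by_cases h : padicLogOmega W p ι P = 0
  · exact Or.inl h
  · exact Or.inr (valuation_padicLogOmega h)

end Log

/-! ### §2 The named fact: Thm. 3.1 ∧ Thm. 3.2 in the `∃∧`-currency of A206 -/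

section Fact

/-- **Castella 2018, Theorem 3.2 (the `p`-adic Waldspurger formula at the trivial character),
jointly with Theorem 3.1 (existence of `L_p(f) ∈ Λ_{R₀}` with its interpolation property)** — named
fact, hypotheses as printed (§2.1: `E/ℚ` semistable of conductor `N` — here `W/ℚ` globally minimal,
`Dt.f` its newform, of square-free level `N` —, `p ≥ 5`, `ρ̄_{E,p}` irreducible; `K` imaginary
quadratic with `p = 𝔭𝔭̄` split, `𝔭` the prime singled out by the embedding datum `ι : ℚ̄_p ≃ ℂ`
(`k ∈ 𝔭 ↔ |ι⁻¹(k)|_p < 1`, `K ⊂ ℂ` read through Mathlib's embedding of its infinite place(s), as in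
A206 `castella2018_exists_isBDPLFunction`); §3 (Heeg): every prime factor of `N` has a prime of `K`
of residue degree one above it; `κ` THE anticyclotomic `ℤ_p`-extension, `γ` a topological generator;
p. 9: a modular parametrisation `π : X₀(N) → E`, `∞ ↦ O`, with (3.2) `π^*(ω_E) = c · ω_f`,
`c ∈ ℤ_{(p)}^×` — here a datum `Dt : ModularParametrizationData W N` with `p ∤ Dt.c` —, and the Heegner
point `P_K := ∑_{σ ∈ Gal(H/K)} π(Δ^σ) ∈ E(K)`, `Δ = [(A, A[𝔑]) − (∞)]` — here `P ∈ E(K)` with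
`P.map w.embedding = heegnerPointComplex Dt H` for a Heegner datum `H` of level `N` and discriminant
`d_K` (the choice of `𝔑`) and an infinite place `w` —, the logarithm `log_{ω_E} : E(K_𝔭) → ℚ_p` being
read along an embedding `e : K →+* ℚ_p` inducing `𝔭`): **there are CM periods `Ω_K ∈ ℂ^×`, `Ω_p ∈ R₀ˣ`
and `L ∈ R₀⟦T⟧ = Λ_{R₀}` such that `IsBDPLFunction ι 𝔭 κ γ f Ω_K Ω_p L` (Thm. 3.1) AND
`L(𝟙) = u · ((1 − a_p p⁻¹ + ε_p) · log_{ω_E} P_K)²` for a unit `u ∈ R₀ˣ` (Thm. 3.2: "the following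
equality holds up to a `p`-adic unit"), `ε_p = p⁻¹` if `p ∤ N` and `ε_p = 0` otherwise,
`a_p = a_p(E)`.** The printed theorems name specific periods (Castella–Hsieh 2018, §2.5), not in the
tree; quantifying them existentially, together with `L`, makes this ONE statement a consequence of
the printed PAIR (Thm. 3.2 is about the `L_p(f)` of Thm. 3.1). SCOPE and flags (module docstring):
for `p ∤ N` the printed proof is [BDP 2013, Thm. 5.13] + [Castella–Hsieh 2018]; for `p ∣ N` it is
"[cas-split]" = Castella, J. Inst. Math. Jussieu 17 (2018), Thm. 2.11 (`p`-new eigenforms, `a_p`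
symbolic; standing setting of that paper: `p ≥ 5` split multiplicative) + [BK] (`AJ_F = log`) + (3.2);
optimality of `E` enters the proof only through (3.2), which is the binder `p ∤ Dt.c` here
(`Cas18-Thm32-parametrisation-via-(3.2)`); nothing is claimed below `p = 5`. Second-level parity rider
`Cas18-Thm32-dK-odd@BDP13` (module docstring): the cited [BDP13]/[cas-split] computations are printed
for `d_K` odd; the statement here is Cas18's, parity-free. Theorems 3.1–3.2 are not
touched by the author's erratum (which replaces Thm. 4.4 and the proof of Thm. A at `p ∥ N` and
re-uses §3 and §5). [cite: Castella2018, Thm. 3.2 with display (3.2) and Thm. 3.1 (arXiv:1704.06608 p. 9)]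
[cite: Castella2018Exceptional, Thm. 2.11 (arXiv:1507.04260 p. 14)]
[cite: CastellaHsieh2018, §2.5 and §3.3] [cite: BertoliniDarmonPrasanna2013, Thm. 5.13] -/
def thm32_exists_isBDPLFunction_valueAtOne : Prop :=
  ∀ {p : ℕ} [Fact p.Prime] (ι : PadicAlgCl p ≃+* ℂ) (W : WeierstrassCurve ℚ) [W.IsElliptic]
    [W.IsGloballyMinimal] (K : Type) [Field K] [NumberField K] (𝔭 : HeightOneSpectrum (𝓞 K))
    (κ : ZpExtension K p) (γ : absoluteGaloisGroup K) {N : ℕ} [NeZero N]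
    (Dt : ModularParametrizationData W N) (H : HeegnerDatum N (NumberField.discr K))
    (w : InfinitePlace K) (e : K →+* ℚ_[p]) (P : (W.baseChange K).toAffine.Point),
    5 ≤ p → Squarefree N → W.HasIrreducibleModPGaloisRep p →
    IsImaginaryQuadratic K → ((Ideal.span {(p : ℤ)}).primesOver (𝓞 K)).ncard = 2 →
    ((p : ℕ) : 𝓞 K) ∈ 𝔭.asIdeal →
    (∀ (w' : InfinitePlace K) (k : 𝓞 K),
      k ∈ 𝔭.asIdeal ↔ ‖ι.symm (w'.embedding (k : K))‖ < 1) →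
    (∀ ℓ : ℕ, ℓ.Prime → ℓ ∣ N → ∃ v : HeightOneSpectrum (𝓞 K), Ideal.absNorm v.asIdeal = ℓ) →
    κ.IsAnticyclotomic → κ.IsTopGenerator γ →
    ¬ (p : ℤ) ∣ Dt.c →
    WeierstrassCurve.Affine.Point.map w.embedding.toRatAlgHom P = heegnerPointComplex Dt H →
    (∀ k : 𝓞 K, k ∈ 𝔭.asIdeal ↔ ‖e (k : K)‖ < 1) →
    ∃ (ΩK : ℂ) (Ωp : (unrIntegers p)ˣ) (L : UnrSeries p),
      ΩK ≠ 0 ∧ IsBDPLFunction ι 𝔭 κ γ Dt.f ΩK ((Ωp : unrIntegers p) : ℂ_[p]) L ∧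
      ∃ u : (unrIntegers p)ˣ, L.HasValueAt 0
        (((u : unrIntegers p) : ℂ_[p]) *
          (algebraMap ℚ_[p] ℂ_[p]
            (((1 : ℚ_[p]) - (W.LFunction p : ℚ_[p]) * (p : ℚ_[p])⁻¹ +
                (if p ∣ N then 0 else (p : ℚ_[p])⁻¹)) * padicLogOmega W p e P)) ^ 2)

end Fact

/-! ### §3 API (proved): the fact delivers A206 on its domain, and the `p ∣ N` shape of the value -/

section API

variable {p : ℕ} [Fact p.Prime]

/-- At `p ∣ N` the factor `ε_p` vanishes: the value reads `u · ((1 − a_p p⁻¹) · log_{ω_E} P_K)²`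
(Cas18 §5: "when `p ∣ N` … `ε_p = 0`"). [cite: Castella2018, Thm. 3.2 (arXiv:1704.06608 p. 9)] -/
theorem valueShape_of_dvd {N : ℕ} (hpN : p ∣ N) (W : WeierstrassCurve ℚ) (x : ℚ_[p]) :
    ((1 : ℚ_[p]) - (W.LFunction p : ℚ_[p]) * (p : ℚ_[p])⁻¹ +
        (if p ∣ N then 0 else (p : ℚ_[p])⁻¹)) * x =
      ((1 : ℚ_[p]) - (W.LFunction p : ℚ_[p]) * (p : ℚ_[p])⁻¹) * x := by
  rw [if_pos hpN, add_zero]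

/-- **Thm. 3.2's fact implies Thm. 3.1's fact (A206) wherever a parametrisation datum with `p ∤ c`, a
Heegner datum, a `K`-rational Heegner point and an embedding inducing `𝔭` are given** (forget the
value clause). [cite: Castella2018, Thms. 3.1–3.2 (arXiv:1704.06608 p. 9)] -/
theorem exists_isBDPLFunction_of_thm32 (h : thm32_exists_isBDPLFunction_valueAtOne)
    (ι : PadicAlgCl p ≃+* ℂ) (W : WeierstrassCurve ℚ) [W.IsElliptic] [W.IsGloballyMinimal]
    (K : Type) [Field K] [NumberField K] (𝔭 : HeightOneSpectrum (𝓞 K)) (κ : ZpExtension K p)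
    (γ : absoluteGaloisGroup K) {N : ℕ} [NeZero N] (Dt : ModularParametrizationData W N)
    (H : HeegnerDatum N (NumberField.discr K)) (w : InfinitePlace K) (e : K →+* ℚ_[p])
    (P : (W.baseChange K).toAffine.Point) (h5 : 5 ≤ p) (hN : Squarefree N)
    (hirr : W.HasIrreducibleModPGaloisRep p) (hK : IsImaginaryQuadratic K)
    (hsplit : ((Ideal.span {(p : ℤ)}).primesOver (𝓞 K)).ncard = 2)
    (h𝔭 : ((p : ℕ) : 𝓞 K) ∈ 𝔭.asIdeal)
    (hcompat : ∀ (w' : InfinitePlace K) (k : 𝓞 K),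
      k ∈ 𝔭.asIdeal ↔ ‖ι.symm (w'.embedding (k : K))‖ < 1)
    (hHeeg : ∀ ℓ : ℕ, ℓ.Prime → ℓ ∣ N → ∃ v : HeightOneSpectrum (𝓞 K), Ideal.absNorm v.asIdeal = ℓ)
    (hκ : κ.IsAnticyclotomic) (hγ : κ.IsTopGenerator γ) (hc : ¬ (p : ℤ) ∣ Dt.c)
    (hP : WeierstrassCurve.Affine.Point.map w.embedding.toRatAlgHom P = heegnerPointComplex Dt H)
    (he : ∀ k : 𝓞 K, k ∈ 𝔭.asIdeal ↔ ‖e (k : K)‖ < 1) :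
    ∃ (ΩK : ℂ) (Ωp : (unrIntegers p)ˣ) (L : UnrSeries p),
      ΩK ≠ 0 ∧ IsBDPLFunction ι 𝔭 κ γ Dt.f ΩK ((Ωp : unrIntegers p) : ℂ_[p]) L := by
  obtain ⟨ΩK, Ωp, L, hΩ, hL, -⟩ :=
    h ι W K 𝔭 κ γ Dt H w e P h5 hN hirr hK hsplit h𝔭 hcompat hHeeg hκ hγ hc hP he
  exact ⟨ΩK, Ωp, L, hΩ, hL⟩

end API

end Literature.NumberTheory.EllipticCurves.Castella2018

end
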